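import Summits.ResolutionOfSingularities.ResolutionOfSingularities.Theorems.WeightedInvariantContactCylinderGlobalMoveDictionary
import Summits.ResolutionOfSingularities.ResolutionOfSingularities.Theorems.WeightedInvariantLexMaxOrderDropOrder
import HarnessLib

/-!
# THE GLOBAL MOVE ON THE LEX-MAX DATUM DROPS THE ORDER OVER THE GENERIC POINT OF THE CURVE ((W-η), variant (V-AQS) of
# res-L1-w43-plan-1 RULING #10; door `HypersurfaceCentreConstruction`, stmt-ResolutionOfSingularities-19897; (D2) HCURVE step of res-type-047)

Topic: `Summits/ResolutionOfSingularities/ResolutionOfSingularities/Theorems`. Helper for the door item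
`HypersurfaceCentreConstruction` (stmt-ResolutionOfSingularities-19897, route `WeightedInvariant`), line `local-engine` of
res-L1-w43-plan-1 (L W4.3).  No new objects.  The (V-AQS) twin of `…ContactCylinderGenericDrop` (p545162): the global move
`B = extReesAlgebra (weightedMonomialIdeal U W)` over `A′` is built on a pair `U : Fin 2 → A′` with COPRIME weights `W` whose image in
`S = A′_{P′}` (regular of dimension two) is the LEX-MAXIMAL weighted centre germ of `(f)` (Abramovich–Quek–Schober); then res-type-098's
`LexMaxOrderDrop.adicOrder_transform_lt_of_isLexMax` at `S`, transported through the local/global dictionary (p538779 (vii)′, kit p542453)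
with the presentation `I′ = weightedMonomialIdeal (U/1) W` (literally 098's carrier), gives: **every prime `𝔫` of `B` over `P′` containing
`t⁻¹` and not containing the vertex has `ord_{B_𝔫}(G/1) < ν`** for the global transform `f = t⁻ᵃ G`, `t⁻¹ ∤ G` — the `hWη` of
res-type-047's `finite_image_comap_of_isConstructible` in the vertex form of his SPEC v2 (`W` on the whole regular `B`).  Also the vertex
transport `map_vertexIdeal_le` / `not_vertexIdeal_le_of_dictionary` (global `𝔫 ⊉ vertex` ⇒ local `𝔫′ ⊉ vertex`).  Excellence-free.

[OURS · L1 W4.3 · (o28)/(D2)]  Replaces the role of NO printed item; NOT a statement of the manuscript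
[claim: Hironaka2017, status: under-review]. AI work, weaker than expert review.  Pure commutative algebra; no named facts.

## References

* D. Abramovich, M. H. Quek, B. Schober, Thm. 1.3 (3), §5. [AbramovichQuekSchober2025]
* J. Włodarczyk, *Functorial resolution except for toroidal locus*, Def. 5.1.1. [Wlodarczyk2022]
* res-L1-w43-plan-1 RULING #10 2026-08-27T15:15:38Z; res-type-047 2026-08-27T15:36:02Z / 15:41:01Z (V-AQS consumer).
-/

noncomputable section

open IsLocalRing Literature.AlgebraicGeometry.Resolution LaurentPolynomial
open Summit.ResolutionOfSingularities.ResolutionOfSingularities.Cruxes.HypersurfaceCentreConstruction.LocalEngine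

set_option linter.dupNamespace false -- mandated namespace of this single-conjunct summit

namespace Summit.ResolutionOfSingularities.ResolutionOfSingularities.Theorems

namespace ContactCylinder

section Vertex

variable {A : Type} [CommRing A] {m : ℕ} (U : Fin m → A) (W : Fin m → ℕ) (𝔮 : Ideal A) [𝔮.IsPrime]
  {I' : ℕ → Ideal (Localization.AtPrime 𝔮)}
  (hI' : ∀ n, I' n = (weightedMonomialIdeal U W n).map (algebraMap A (Localization.AtPrime 𝔮)))
  (ψ : extReesAlgebra (weightedMonomialIdeal U W) →+* extReesAlgebra I')
  (hψ : ∀ b : extReesAlgebra (weightedMonomialIdeal U W), ((ψ b : extReesAlgebra I') : (Localization.AtPrime 𝔮)[T;T⁻¹]) =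
    AddMonoidAlgebra.mapRingHom ℤ (algebraMap A (Localization.AtPrime 𝔮)) (b : A[T;T⁻¹]))

include hI' hψ in
/-- **The dictionary maps the global vertex ideal into the local one**: `ψ (vertexIdeal 𝒥(U, W)) ⊆ vertexIdeal I′` (generators
`a tⁿ`, `a ∈ 𝒥ₙ`, go to `(a/1) tⁿ`, `a/1 ∈ I′ n`). [cite: Wlodarczyk2022, Def. 2.3.5] -/
theorem map_vertexIdeal_le :
    (extReesAlgebra.vertexIdeal (weightedMonomialIdeal U W)).map ψ ≤ extReesAlgebra.vertexIdeal I' := by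
  refine Ideal.map_le_of_le_comap (Ideal.span_le.mpr ?_)
  rintro b ⟨n, hn, a, ha, hb⟩
  rw [SetLike.mem_coe, Ideal.mem_comap]
  refine Ideal.subset_span ⟨n, hn, algebraMap A (Localization.AtPrime 𝔮) a, ?_, ?_⟩
  · rw [hI']
    exact Ideal.mem_map_of_mem _ ha
  · rw [hψ, hb, ← single_eq_C_mul_T, AddMonoidAlgebra.mapRingHom_single, single_eq_C_mul_T]

include hI' hψ in
/-- **Vertex transport**: if the global prime `𝔫 = ψ⁻¹ 𝔫′` does not contain the vertex ideal, neither does `𝔫′` — the «off the vertex»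
binder of the (drop) theorems at `𝔫′` from the vertex form of the global no-drop locus. [folklore] -/
theorem not_vertexIdeal_le_of_dictionary {𝔫 : Ideal (extReesAlgebra (weightedMonomialIdeal U W))} {𝔫' : Ideal (extReesAlgebra I')}
    (hcomap : 𝔫'.comap ψ = 𝔫) (hV : ¬ extReesAlgebra.vertexIdeal (weightedMonomialIdeal U W) ≤ 𝔫) :
    ¬ extReesAlgebra.vertexIdeal I' ≤ 𝔫' := fun hle =>
  hV (fun b hb => by
    rw [← hcomap, Ideal.mem_comap]
    exact hle (map_vertexIdeal_le U W 𝔮 hI' ψ hψ (Ideal.mem_map_of_mem ψ hb)))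

end Vertex

/-! ## (W-η) for the lex-max datum -/

/-- **(W-η), VARIANT (V-AQS): THE NO-DROP LOCUS OF THE GLOBAL MOVE ON THE LEX-MAX DATUM MISSES THE GENERIC POINT OF THE CURVE.**
`A′` a ring, `U : Fin 2 → A′` with weights `W`, global move `B = extReesAlgebra (weightedMonomialIdeal U W)`; `P′` a prime with
`S = A′_{P′}` regular of dimension two; `f ∈ A′` with `ord_S (f/1) = ν ≥ 2` and `(U/1; W; ℓ)`, `ℓ = W 0 · ν`, the LEX-MAXIMAL weighted centre
germ of `(f/1)` in `S`; the pieces `𝒥ₙ(U, W)` contracted from `S` (`(𝒥ₙ S) ∩ A′ = 𝒥ₙ`, `…GlobalMoveContracted`).  Then for the global transform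
`f = t⁻ᵃ G`, `t⁻¹ ∤ G`, every prime `𝔫` of `B` lying over `P′` with `t⁻¹ ∈ 𝔫` and `vertex ⊄ 𝔫` satisfies
**`ord_{B_𝔫}(G/1) < ν`** — res-type-098's `adicOrder_transform_lt_of_isLexMax` at `S`, through the dictionary with `I′ = 𝒥(U/1, W)`.
[cite: AbramovichQuekSchober2025, Thm 1.3 (3), §5; Wlodarczyk2022, Def. 5.1.1] -/
theorem transform_adicOrder_lt_of_over_generic_point_of_isLexMax {A' : Type} [CommRing A'] (U : Fin 2 → A') (W : Fin 2 → ℕ)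
    (P' : Ideal A') [P'.IsPrime] [IsRegularLocalRing (Localization.AtPrime P')]
    (hdim : ringKrullDim (Localization.AtPrime P') = 2) (f : A') {ℓ ν : ℕ}
    (hlex : IsLexMaxWeightedCentreGerm (Localization.AtPrime P') (Ideal.span {algebraMap A' (Localization.AtPrime P') f})
      (fun i => algebraMap A' (Localization.AtPrime P') (U i)) W ℓ)
    (hℓ : ℓ = W 0 * ν) (hν : 2 ≤ ν) (hord : adicOrder (algebraMap A' (Localization.AtPrime P') f) = (ν : ℕ∞))
    (hcontr : ∀ n, ((weightedMonomialIdeal U W n).map (algebraMap A' (Localization.AtPrime P'))).comap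
      (algebraMap A' (Localization.AtPrime P')) = weightedMonomialIdeal U W n)
    (𝔫 : Ideal (extReesAlgebra (weightedMonomialIdeal U W))) [𝔫.IsPrime]
    (h𝔫 : 𝔫.comap (algebraMap A' (extReesAlgebra (weightedMonomialIdeal U W))) = P')
    (hT : extReesAlgebra.tInv (weightedMonomialIdeal U W) ∈ 𝔫)
    (hV : ¬ extReesAlgebra.vertexIdeal (weightedMonomialIdeal U W) ≤ 𝔫)
    (a : ℕ) (G : extReesAlgebra (weightedMonomialIdeal U W))
    (hfG : algebraMap A' (extReesAlgebra (weightedMonomialIdeal U W)) f = extReesAlgebra.tInv (weightedMonomialIdeal U W) ^ a * G)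
    (hTG : ¬ extReesAlgebra.tInv (weightedMonomialIdeal U W) ∣ G) :
    adicOrder (algebraMap (extReesAlgebra (weightedMonomialIdeal U W)) (Localization.AtPrime 𝔫) G) < (ν : ℕ∞) := by
  -- the dictionary at `𝔮 = P′` with the presentation `I' = 𝒥(U/1, W)` (res-type-098's carrier)
  have hI' : ∀ n, weightedMonomialIdeal (fun i => algebraMap A' (Localization.AtPrime P') (U i)) W n =
      (weightedMonomialIdeal U W n).map (algebraMap A' (Localization.AtPrime P')) :=
    fun n => (weightedMonomialIdeal_map _ U W n).symm
  have hd := disjoint_map_primeCompl_of_comap_eq P' 𝔫 h𝔫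
  obtain ⟨ψ, 𝔫', h𝔫', g, hψc, hψa, hψt, hcomap, hg⟩ :=
    exists_ringHom_prime_ringEquiv_localMove' U W P' hI' 𝔫 hd
  -- the binders of res-type-098's theorem at `𝔫'`
  have hT' : extReesAlgebra.tInv _ ∈ 𝔫' := by
    rw [← hψt]
    exact (mem_iff_map_mem_of_comap_eq U W P' ψ hcomap _).mp hT
  have hM' : (maximalIdeal (Localization.AtPrime P')).map (algebraMap (Localization.AtPrime P') (extReesAlgebra _)) ≤ 𝔫' := by
    rw [← Localization.AtPrime.map_eq_maximalIdeal, ← map_algebraMap_le_iff_of_dictionary U W P' ψ hψa hcomap P',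
      Ideal.map_le_iff_le_comap, h𝔫]
  have hV' := not_vertexIdeal_le_of_dictionary U W P' hI' ψ hψc hcomap hV
  have hfG' : algebraMap (Localization.AtPrime P') (extReesAlgebra _) (algebraMap A' (Localization.AtPrime P') f) =
      extReesAlgebra.tInv _ ^ a * ψ G := by
    rw [← hψa, hfG, map_mul, map_pow, hψt]
  have hTG' : ¬ extReesAlgebra.tInv _ ∣ ψ G := by
    refine not_tInv_dvd_map_of_forall U W P' hI' ψ hψc G hTG fun n hn => ?_
    rw [hI' n] at hn
    have h := Ideal.mem_comap.mpr hn
    rwa [hcontr n] at h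
  -- res-type-098's generic drop at `𝔫'`, transported along `g`
  have hlt := LexMaxOrderDrop.adicOrder_transform_lt_of_isLexMax hdim hlex hℓ hν hord 𝔫' hT' hM' hV' a (ψ G) hfG' hTG'
  rwa [adicOrder_eq_of_dictionary ψ 𝔫 𝔫' g hg G] at hlt

/-- Membership form of the same: `G/1 ∉ 𝔪_{B_𝔫}^ν`. [cite: AbramovichQuekSchober2025, Thm 1.3 (3), §5] -/
theorem transform_not_mem_pow_of_over_generic_point_of_isLexMax {A' : Type} [CommRing A'] (U : Fin 2 → A') (W : Fin 2 → ℕ)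
    (P' : Ideal A') [P'.IsPrime] [IsRegularLocalRing (Localization.AtPrime P')]
    (hdim : ringKrullDim (Localization.AtPrime P') = 2) (f : A') {ℓ ν : ℕ}
    (hlex : IsLexMaxWeightedCentreGerm (Localization.AtPrime P') (Ideal.span {algebraMap A' (Localization.AtPrime P') f})
      (fun i => algebraMap A' (Localization.AtPrime P') (U i)) W ℓ)
    (hℓ : ℓ = W 0 * ν) (hν : 2 ≤ ν) (hord : adicOrder (algebraMap A' (Localization.AtPrime P') f) = (ν : ℕ∞))
    (hcontr : ∀ n, ((weightedMonomialIdeal U W n).map (algebraMap A' (Localization.AtPrime P'))).comap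
      (algebraMap A' (Localization.AtPrime P')) = weightedMonomialIdeal U W n)
    (𝔫 : Ideal (extReesAlgebra (weightedMonomialIdeal U W))) [𝔫.IsPrime]
    (h𝔫 : 𝔫.comap (algebraMap A' (extReesAlgebra (weightedMonomialIdeal U W))) = P')
    (hT : extReesAlgebra.tInv (weightedMonomialIdeal U W) ∈ 𝔫)
    (hV : ¬ extReesAlgebra.vertexIdeal (weightedMonomialIdeal U W) ≤ 𝔫)
    (a : ℕ) (G : extReesAlgebra (weightedMonomialIdeal U W))
    (hfG : algebraMap A' (extReesAlgebra (weightedMonomialIdeal U W)) f = extReesAlgebra.tInv (weightedMonomialIdeal U W) ^ a * G)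
    (hTG : ¬ extReesAlgebra.tInv (weightedMonomialIdeal U W) ∣ G) :
    algebraMap (extReesAlgebra (weightedMonomialIdeal U W)) (Localization.AtPrime 𝔫) G ∉ maximalIdeal (Localization.AtPrime 𝔫) ^ ν :=
  fun hmem => (not_le.mpr (transform_adicOrder_lt_of_over_generic_point_of_isLexMax U W P' hdim f hlex hℓ hν hord hcontr 𝔫 h𝔫 hT
    hV a G hfG hTG)) ((le_adicOrder_iff _ ν).mpr hmem)

end ContactCylinder

end Summit.ResolutionOfSingularities.ResolutionOfSingularities.Theorems

end
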